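import Summits.QuantumFields.YangMills.Theorems.FlatTubeReductionFibredBOProj
import HarnessLib

/-!
# Fibred Born–Oppenheimer blocks — EQUIVARIANCE of the adiabatic split under a diagonal action `(c, q) ↦ (a c, R q)`
# (rate twin of `stub_boRate`, crux K1 `NearFlatRatioLaw` stmt-QuantumFields-24720, line «borate»; the `hinv` input of `…KernelTwist` for projected test functions)

After the crux disprover's R32/R33 on `TwistedTraceScaling` (20203) the transfer step of the rate twin compares `K̃_β` with the TWISTED fibred model (`Theorems/FlatTubeReductionKernelTwist.lean`,
`Cruxes/NearFlatRatioLaw/Lines/borate-twist-g8.md`); untwisting (`KernelTwist.integral_integral_twist_eq`) needs the TEST FUNCTIONS to be invariant under the diagonal constant-gauge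
action `(c, q) ↦ (a_g c, R_g q)` of the tube domain.  The tube images of gauge-invariant families are invariant (`ConstTube.comp_slowEmb_constGauge`); this file shows that the
adiabatic split of `…FibredBOProj` preserves invariance as soon as the fibre PROFILE is EQUIVARIANT, `Ω_{a c}(R q) = Ω_c(q)`, and the fibre measure `π` is `R`-invariant
(`ConstTube.orthoTransverse_map_colourRotate`): for one pair of maps `a : C → C`, `R : Q ≃ᵐ Q` at a time (no group structure needed),
* ★ `fibredCoeff_comp_eq` — `f(a c) = f(c)` for the slow profile `f = fibredCoeff π Ω Φ` of an invariant `Φ`;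
* ★ `fibredProj_comp_eq`, ★ `fibredOrth_comp_eq` — `PΦ` and `χ = Φ − PΦ` are invariant;
* `prodState_comp_eq` — a product state `f ⊗ Ω` with invariant `f` is invariant.
HONEST FRAMING: three-line Fubini/change-of-variables bookkeeping for the registered stub of a crux of the CONDITIONAL reduction route `FlatTubeReduction` (R2b1 RECORD-label femto
rung); the chart, the frozen fibre profiles and `stub_boRate` are untouched; not infinite volume, not a mass gap, not Clay.
-/

set_option autoImplicit false

noncomputable section

open MeasureTheory

namespace Summit.QuantumFields.YangMills.Theorems.FemtoTransferGap.FibredBO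

variable {C Q : Type*} [MeasurableSpace Q]
variable {π : Measure Q} {Ω : C → Q → ℝ} {a : C → C} {R : Q ≃ᵐ Q}

/-- ★ **The slow profile of an invariant state is invariant**: `Φ(a c, R q) = Φ(c, q)`, `Ω_{a c}(R q) = Ω_c(q)`, `π` `R`-invariant ⇒ `f(a c) = f(c)` for
`f = fibredCoeff π Ω Φ`. [cite: GustafsonSigal2003, §12] -/
theorem fibredCoeff_comp_eq (hR : MeasurePreserving R π π) {Φ : C × Q → ℝ} (hΦ : ∀ c q, Φ (a c, R q) = Φ (c, q))
    (hΩ : ∀ c q, Ω (a c) (R q) = Ω c q) (c : C) : fibredCoeff π Ω Φ (a c) = fibredCoeff π Ω Φ c := by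
  unfold fibredCoeff
  rw [← hR.integral_comp' (fun q => Φ (a c, q) * Ω (a c) q)]
  exact integral_congr_ae (ae_of_all _ fun q => by simp only [hΦ, hΩ])

/-- ★ **The adiabatic projection of an invariant state is invariant**: `(PΦ)(a c, R q) = (PΦ)(c, q)`. [cite: GustafsonSigal2003, §12] -/
theorem fibredProj_comp_eq (hR : MeasurePreserving R π π) {Φ : C × Q → ℝ} (hΦ : ∀ c q, Φ (a c, R q) = Φ (c, q))
    (hΩ : ∀ c q, Ω (a c) (R q) = Ω c q) (c : C) (q : Q) : fibredProj π Ω Φ (a c, R q) = fibredProj π Ω Φ (c, q) := by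
  simp only [fibredProj, fibredCoeff_comp_eq hR hΦ hΩ, hΩ]

/-- ★ **The adiabatic complement of an invariant state is invariant**: `χ(a c, R q) = χ(c, q)` for `χ = Φ − PΦ`. [cite: GustafsonSigal2003, §12] -/
theorem fibredOrth_comp_eq (hR : MeasurePreserving R π π) {Φ : C × Q → ℝ} (hΦ : ∀ c q, Φ (a c, R q) = Φ (c, q))
    (hΩ : ∀ c q, Ω (a c) (R q) = Ω c q) (c : C) (q : Q) : fibredOrth π Ω Φ (a c, R q) = fibredOrth π Ω Φ (c, q) := by
  simp only [fibredOrth, fibredProj_comp_eq hR hΦ hΩ, hΦ]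

omit [MeasurableSpace Q] in
/-- A product state `f ⊗ Ω` with invariant slow profile and equivariant fibre profile is invariant. [folklore] -/
theorem prodState_comp_eq {R : Q → Q} {f : C → ℝ} (hf : ∀ c, f (a c) = f c) (hΩ : ∀ c q, Ω (a c) (R q) = Ω c q) (c : C) (q : Q) :
    f (a c) * Ω (a c) (R q) = f c * Ω c q := by
  rw [hf, hΩ]

end Summit.QuantumFields.YangMills.Theorems.FemtoTransferGap.FibredBO

end
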